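import Summits.QuantumFields.BalabanUV.T4Continuum.Support.NE7RadIterUniform
import HarnessLib

/-!
# NE7HierarchicalBookkeeping — THE j-UNIFORM REAL-ANALYSIS BOOKKEEPING OF A HIERARCHICAL FIBRE REPRESENTATIVE: a top-down one-step mass recursion `M_{t+1} ≤ ρ_t·M_t + B_t` (depth `t`
# from the coarse datum, `M_0 = ‖v‖`) whose step factors have a uniform product bound `Π_{l∈[a,b)} ρ_l ≤ P·L^{b−a}` (e.g. SHARP lifts `ρ_l ≤ L·(1+κ_l)`, `Σκ_l ≤ K`, `P = e^K`) and uniform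
# sources `B_t ≤ B̄` gives `M_t ≤ P(M_0 + B̄)·L^t`, hence — with ROOM `L` per level — the three sums the sliced curved lower bound needs, UNIFORMLY IN THE NUMBER OF LEVELS:
# the tower remainder `Σ_t L^{−2t}M_t ≤ Q`, the scaled bottom mass `L^{−T}M_T ≤ Q`, the multiplier masses `Σ_t L^{−3(t−1)}M_t² ≤ 2Q²L²` (`Q = P(M_0 + B̄)`)
# (lineage `b2b-balaban-t4-ne7-p1`, gen 118, file G6; memo ROAD-G118 §3 — the socket for row NE7b's hierarchical representative (H′))

Cell `pub-balaban`, rung (B)+1 sub-cell t4, CRUX PROVER NE7 #1 (OWNER of row NE7), generation 118.  WHY.  The (G′) assembly on a HIERARCHICAL representative `X_h` (one-level slices at every level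
`i = 0..j`, hierarchically frame-free; row NE7b g162's (H′)) needs three level sums j-uniformly: (T1) the tower remainder `Σ_i eC·a_i·√N_i` of this gen's G5 ✓ `NE7LevelwiseTowerCurlEnergy`
(`a_i ≤ 2ε·L^{−2(j+1−i)}` by ✓ `NE7RadIterUniform`), (T2) the scaled bottom mass `η·√N_0`, `η = L^{−(j+1)}` (the small-field non-convexity term `7a₀·Σ bondSq` of ✓ `hess_self_ge_nhs`), (T3) the
multiplier masses `Σ_i (L∕L⁴)^{j−i}·N_i` of row NE7b's ✓ `multiplierTerm_le_levelMasses`.  All three follow from ONE fact about the representative: in DEPTH indexing `t = j+1−i` (`M_t = √N_{j+1−t}`,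
`M_0 = ‖v‖`) the one-step slice letters in ROOT (Minkowski) form read `M_{t+1} ≤ ρ_t·M_t + B_t` with `ρ_t = ‖lift‖ ≤ L^{(d−2)∕2}·√(1+κ_t)` (`= L·√(1+κ_t)` in `d = 4`; SHARP lifts: `Σκ_t = O(ε)`)
and `B_t = L√C_P·(level energies) ≤ B̄`.  A Peter–Paul form `(1+θ)ρ_t²M_t² + (1+θ⁻¹)B_t²` would lose `(1+θ)^{T}` and is NOT used.  THIS FILE is the pure real analysis ([folklore]; 0 def, 0 sorry):
* §1 `forward_gronwall` — `M_t ≤ (Π_{l<t}ρ_l)·M_0 + Σ_{k<t}(Π_{l∈[k+1,t)}ρ_l)·B_k`;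
* §2 `forward_bound_of_prod` — with `Π_{[a,b)}ρ ≤ P·L^{b−a}`: `M_t ≤ P·(L^t·M_0 + Σ_{k<t} L^{t−1−k}·B_k)`; §3 `prod_Ico_le_exp_mul_pow` — `ρ_l ≤ L(1+κ_l)`, `Σ_{l<T}κ_l ≤ K` ⟹ `P = e^K`;
* §4 `depth_bound` — `B_k ≤ B̄` ⟹ **`M_t ≤ P·(M_0 + B̄)·L^t`** (`L ≥ 2`); §5 **`sum_sq_weight_le`** (T1), **`top_weight_le`** (T2), **`sum_cube_weight_sq_le`** (T3) from `M_t ≤ Q·L^t`;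
* §6 `le_two_mul_of_le_add_mul` — the absorption `S ≤ α + βS`, `β ≤ 1∕2` ⟹ `S ≤ 2α` (closing the energy feedback `B̄ = A·(e_0 + c·(T1))`); §7 `depth_recursion_of_level` — the re-indexing
  from level-indexed letters `m_i ≤ ρ′_i·m_{i+1} + B′_i` (`i < T`) to the depth recursion.
HONEST FRAMING: real inequalities only; which representative satisfies the displayed recursion (row NE7b's (H′) with a sharp Whitney-type lift) is NOT asserted here; nothing of Bałaban's asserted
([Balaban1985PropagatorsII] Thm 3.3 (3.46) context); NOT (G′), NOT NE7 as a spine node; spine 0∕9; finite T⁴ rung (B)+1 — NOT infinite volume, NOT mass gap, NOT BetaPertH, NOT Clay.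
-/

set_option autoImplicit false

open scoped BigOperators
open Finset

namespace Summit.QuantumFields.BalabanUV.T4Continuum.NE7HierarchicalBookkeeping

open NE7RadIterUniform (geom_sum_le_two)

noncomputable section

/-! ## §1 The forward (top-down) recursion, solved -/

/-- **DISCRETE GRÖNWALL, FORWARD**: `M (t+1) ≤ ρ t·M t + B t` (`t < T`, `0 ≤ ρ t`) ⟹ `M t ≤ (Π_{l<t} ρ l)·M 0 + Σ_{k<t} (Π_{l∈[k+1,t)} ρ l)·B k` for `t ≤ T`. [folklore] -/
theorem forward_gronwall {M ρ B : ℕ → ℝ} {T : ℕ} (hρ : ∀ t < T, 0 ≤ ρ t) (hM : ∀ t < T, M (t + 1) ≤ ρ t * M t + B t) :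
    ∀ t ≤ T, M t ≤ (∏ l ∈ range t, ρ l) * M 0 + ∑ k ∈ range t, (∏ l ∈ Ico (k + 1) t, ρ l) * B k := by
  intro t
  induction t with
  | zero => intro _; simp
  | succ t ih =>
      intro ht
      have ht' : t < T := Nat.lt_of_succ_le ht
      have hb := ih ht'.le
      calc M (t + 1) ≤ ρ t * M t + B t := hM t ht'
        _ ≤ ρ t * ((∏ l ∈ range t, ρ l) * M 0 + ∑ k ∈ range t, (∏ l ∈ Ico (k + 1) t, ρ l) * B k) + B t :=
            add_le_add (mul_le_mul_of_nonneg_left hb (hρ t ht')) le_rfl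
        _ = (∏ l ∈ range (t + 1), ρ l) * M 0 + ∑ k ∈ range (t + 1), (∏ l ∈ Ico (k + 1) (t + 1), ρ l) * B k := by
            rw [Finset.prod_range_succ, Finset.sum_range_succ, Finset.Ico_self, Finset.prod_empty, one_mul, mul_add, Finset.mul_sum]
            have e : ∀ k ∈ range t, ρ t * ((∏ l ∈ Ico (k + 1) t, ρ l) * B k) = (∏ l ∈ Ico (k + 1) (t + 1), ρ l) * B k := by
              intro k hk
              rw [Finset.prod_Ico_succ_top (Nat.succ_le_of_lt (Finset.mem_range.mp hk))]
              ring
            rw [Finset.sum_congr rfl e]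
            ring

/-! ## §2 With a uniform product bound on the step factors -/

/-- **FORWARD BOUND WITH ROOM**: if moreover `Π_{l∈[a,b)} ρ l ≤ P·L^{b−a}` for all `a ≤ b ≤ T`, `0 ≤ M 0`, `0 ≤ B k`, then
`M t ≤ P·(L^t·M 0 + Σ_{k<t} L^{t−1−k}·B k)` for `t ≤ T` (any real `L`). [folklore] -/
theorem forward_bound_of_prod {M ρ B : ℕ → ℝ} {T : ℕ} {P Lr : ℝ} (hρ : ∀ t < T, 0 ≤ ρ t) (hB : ∀ t < T, 0 ≤ B t) (hM0 : 0 ≤ M 0)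
    (hM : ∀ t < T, M (t + 1) ≤ ρ t * M t + B t) (hprod : ∀ a b : ℕ, a ≤ b → b ≤ T → ∏ l ∈ Ico a b, ρ l ≤ P * Lr ^ (b - a)) :
    ∀ t ≤ T, M t ≤ P * (Lr ^ t * M 0 + ∑ k ∈ range t, Lr ^ (t - 1 - k) * B k) := by
  intro t ht
  have h := forward_gronwall hρ hM t ht
  have h1 : (∏ l ∈ range t, ρ l) * M 0 ≤ P * Lr ^ t * M 0 := by
    refine mul_le_mul_of_nonneg_right ?_ hM0
    have := hprod 0 t (Nat.zero_le _) ht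
    rw [Finset.range_eq_Ico]; simpa using this
  have h2 : ∑ k ∈ range t, (∏ l ∈ Ico (k + 1) t, ρ l) * B k ≤ ∑ k ∈ range t, P * Lr ^ (t - 1 - k) * B k := by
    refine Finset.sum_le_sum fun k hk => ?_
    have hkt : k < t := Finset.mem_range.mp hk
    refine mul_le_mul_of_nonneg_right ?_ (hB k (lt_of_lt_of_le hkt ht))
    have := hprod (k + 1) t (Nat.succ_le_of_lt hkt) ht
    have e : t - (k + 1) = t - 1 - k := by omega
    rw [e] at this; exact this
  calc M t ≤ (∏ l ∈ range t, ρ l) * M 0 + ∑ k ∈ range t, (∏ l ∈ Ico (k + 1) t, ρ l) * B k := h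
    _ ≤ P * Lr ^ t * M 0 + ∑ k ∈ range t, P * Lr ^ (t - 1 - k) * B k := add_le_add h1 h2
    _ = P * (Lr ^ t * M 0 + ∑ k ∈ range t, Lr ^ (t - 1 - k) * B k) := by
        rw [mul_add, Finset.mul_sum]
        congr 1
        · ring
        · exact Finset.sum_congr rfl fun k _ => by ring

/-! ## §3 Sharp step factors: the product bound from `ρ_l ≤ L·(1 + κ_l)`, `Σ κ_l ≤ K` -/

/-- **SHARP LIFTS GIVE ROOM**: `0 ≤ ρ l ≤ L·(1 + κ l)`, `0 ≤ κ l`, `Σ_{l<T} κ l ≤ K`, `0 ≤ L` ⟹ `Π_{l∈[a,b)} ρ l ≤ e^K·L^{b−a}` for `a ≤ b ≤ T`. [folklore] -/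
theorem prod_Ico_le_exp_mul_pow {ρ κ : ℕ → ℝ} {T : ℕ} {Lr K : ℝ} (hLr : 0 ≤ Lr) (hρ0 : ∀ l < T, 0 ≤ ρ l) (hκ : ∀ l < T, 0 ≤ κ l)
    (hρ : ∀ l < T, ρ l ≤ Lr * (1 + κ l)) (hK : ∑ l ∈ range T, κ l ≤ K) :
    ∀ a b : ℕ, a ≤ b → b ≤ T → ∏ l ∈ Ico a b, ρ l ≤ Real.exp K * Lr ^ (b - a) := by
  intro a b _ hbT
  have hmem : ∀ l ∈ Ico a b, l < T := fun l hl => lt_of_lt_of_le (Finset.mem_Ico.mp hl).2 hbT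
  have h1 : ∏ l ∈ Ico a b, ρ l ≤ ∏ l ∈ Ico a b, (Lr * (1 + κ l)) :=
    Finset.prod_le_prod (fun l hl => hρ0 l (hmem l hl)) (fun l hl => hρ l (hmem l hl))
  have h2 : ∏ l ∈ Ico a b, (Lr * (1 + κ l)) = Lr ^ (b - a) * ∏ l ∈ Ico a b, (1 + κ l) := by
    rw [Finset.prod_mul_distrib, Finset.prod_const, Nat.card_Ico]
  have h3 : ∏ l ∈ Ico a b, (1 + κ l) ≤ Real.exp K := by
    calc ∏ l ∈ Ico a b, (1 + κ l) ≤ ∏ l ∈ Ico a b, Real.exp (κ l) :=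
          Finset.prod_le_prod (fun l hl => by have := hκ l (hmem l hl); positivity) (fun l _ => by
            have := Real.add_one_le_exp (κ l); linarith)
      _ = Real.exp (∑ l ∈ Ico a b, κ l) := (Real.exp_sum _ _).symm
      _ ≤ Real.exp K := by
          refine Real.exp_le_exp.mpr ((Finset.sum_le_sum_of_subset_of_nonneg ?_ ?_).trans hK)
          · intro l hl
            exact Finset.mem_range.mpr (hmem l hl)
          · intro l hl _
            exact hκ l (Finset.mem_range.mp hl)
  calc ∏ l ∈ Ico a b, ρ l ≤ Lr ^ (b - a) * ∏ l ∈ Ico a b, (1 + κ l) := h1.trans (le_of_eq h2)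
    _ ≤ Lr ^ (b - a) * Real.exp K := mul_le_mul_of_nonneg_left h3 (pow_nonneg hLr _)
    _ = Real.exp K * Lr ^ (b - a) := mul_comm _ _

/-! ## §4 Uniform sources: `M_t ≤ P·(M_0 + B̄)·L^t` -/

/-- `Σ_{k<t} L^{t−1−k} ≤ L^t` for `L ≥ 2`. [folklore] -/
theorem sum_pow_sub_le {Lr : ℝ} (hL2 : 2 ≤ Lr) (t : ℕ) : ∑ k ∈ range t, Lr ^ (t - 1 - k) ≤ Lr ^ t := by
  rw [Finset.sum_range_reflect (fun k => Lr ^ k) t, geom_sum_eq (by linarith) t]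
  have h1 : 1 ≤ Lr - 1 := by linarith
  have hLt : 0 ≤ Lr ^ t := pow_nonneg (by linarith) _
  rw [div_le_iff₀ (by linarith)]
  nlinarith

/-- **THE DEPTH BOUND**: `M t ≤ P·(L^t·M 0 + Σ_{k<t} L^{t−1−k}·B k)` (`t ≤ T`), `B k ≤ B̄` (`k < T`), `0 ≤ B̄`, `0 ≤ P`, `L ≥ 2` ⟹ `M t ≤ P·(M 0 + B̄)·L^t` for `t ≤ T`. [folklore] -/
theorem depth_bound {M B : ℕ → ℝ} {T : ℕ} {P Lr Bbar : ℝ} (hL2 : 2 ≤ Lr) (hP : 0 ≤ P) (hB0 : 0 ≤ Bbar) (hBbar : ∀ k < T, B k ≤ Bbar)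
    (hMt : ∀ t ≤ T, M t ≤ P * (Lr ^ t * M 0 + ∑ k ∈ range t, Lr ^ (t - 1 - k) * B k)) :
    ∀ t ≤ T, M t ≤ P * (M 0 + Bbar) * Lr ^ t := by
  intro t ht
  have hL0 : 0 ≤ Lr := by linarith
  have hsum : ∑ k ∈ range t, Lr ^ (t - 1 - k) * B k ≤ Bbar * Lr ^ t := by
    calc ∑ k ∈ range t, Lr ^ (t - 1 - k) * B k ≤ ∑ k ∈ range t, Lr ^ (t - 1 - k) * Bbar :=
          Finset.sum_le_sum fun k hk => mul_le_mul_of_nonneg_left (hBbar k (lt_of_lt_of_le (Finset.mem_range.mp hk) ht)) (pow_nonneg hL0 _)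
      _ = Bbar * ∑ k ∈ range t, Lr ^ (t - 1 - k) := by rw [Finset.mul_sum]; exact Finset.sum_congr rfl fun k _ => mul_comm _ _
      _ ≤ Bbar * Lr ^ t := mul_le_mul_of_nonneg_left (sum_pow_sub_le hL2 t) hB0
  calc M t ≤ P * (Lr ^ t * M 0 + ∑ k ∈ range t, Lr ^ (t - 1 - k) * B k) := hMt t ht
    _ ≤ P * (Lr ^ t * M 0 + Bbar * Lr ^ t) := mul_le_mul_of_nonneg_left (add_le_add le_rfl hsum) hP
    _ = P * (M 0 + Bbar) * Lr ^ t := by ring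

/-! ## §5 The three sums from `M_t ≤ Q·L^t` -/

/-- **(T1) THE TOWER REMAINDER SUM**: `M (s+1) ≤ Q·L^{s+1}` (`s < T`), `0 ≤ Q`, `L ≥ 2` ⟹ `Σ_{s<T} (L⁻¹)^{2(s+1)}·M (s+1) ≤ Q` (the radii `a_i ≈ ε·L^{−2·depth}` against masses growing like
`L^{depth}`: room `L` per level). [folklore] -/
theorem sum_sq_weight_le {M : ℕ → ℝ} {T : ℕ} {Q Lr : ℝ} (hL2 : 2 ≤ Lr) (hQ : 0 ≤ Q) (hMt : ∀ s < T, M (s + 1) ≤ Q * Lr ^ (s + 1)) :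
    ∑ s ∈ range T, (Lr⁻¹) ^ (2 * (s + 1)) * M (s + 1) ≤ Q := by
  have hL0 : 0 < Lr := by linarith
  have hq0 : 0 ≤ Lr⁻¹ := by positivity
  have hq2 : Lr⁻¹ ≤ 1 / 2 := by rw [inv_eq_one_div]; exact one_div_le_one_div_of_le (by norm_num) hL2
  have hterm : ∀ s ∈ range T, (Lr⁻¹) ^ (2 * (s + 1)) * M (s + 1) ≤ Q * (Lr⁻¹ * (Lr⁻¹) ^ s) := by
    intro s hs
    have h := mul_le_mul_of_nonneg_left (hMt s (Finset.mem_range.mp hs)) (pow_nonneg hq0 (2 * (s + 1)))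
    refine h.trans (le_of_eq ?_)
    have e : (Lr⁻¹) ^ (2 * (s + 1)) * Lr ^ (s + 1) = (Lr⁻¹) ^ (s + 1) := by
      have e1 : (Lr⁻¹) ^ (2 * (s + 1)) = (Lr⁻¹) ^ (s + 1) * (Lr⁻¹) ^ (s + 1) := by rw [two_mul, pow_add]
      rw [e1, mul_assoc, ← mul_pow, inv_mul_cancel₀ hL0.ne', one_pow, mul_one]
    calc (Lr⁻¹) ^ (2 * (s + 1)) * (Q * Lr ^ (s + 1)) = Q * ((Lr⁻¹) ^ (2 * (s + 1)) * Lr ^ (s + 1)) := by ring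
      _ = Q * (Lr⁻¹ * (Lr⁻¹) ^ s) := by rw [e, pow_succ']
  calc ∑ s ∈ range T, (Lr⁻¹) ^ (2 * (s + 1)) * M (s + 1) ≤ ∑ s ∈ range T, Q * (Lr⁻¹ * (Lr⁻¹) ^ s) := Finset.sum_le_sum hterm
    _ = Q * Lr⁻¹ * ∑ s ∈ range T, (Lr⁻¹) ^ s := by rw [Finset.mul_sum]; exact Finset.sum_congr rfl fun s _ => by ring
    _ ≤ Q * (1 / 2) * 2 := by
        have hg := geom_sum_le_two hq0 hq2 T
        have hgs : 0 ≤ ∑ s ∈ range T, (Lr⁻¹) ^ s := Finset.sum_nonneg fun s _ => pow_nonneg hq0 _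
        calc Q * Lr⁻¹ * ∑ s ∈ range T, (Lr⁻¹) ^ s ≤ Q * (1 / 2) * ∑ s ∈ range T, (Lr⁻¹) ^ s :=
              mul_le_mul_of_nonneg_right (mul_le_mul_of_nonneg_left hq2 hQ) hgs
          _ ≤ Q * (1 / 2) * 2 := mul_le_mul_of_nonneg_left hg (by positivity)
    _ = Q := by ring

/-- **(T2) THE SCALED BOTTOM MASS**: `M T ≤ Q·L^T`, `0 < L` ⟹ `(L⁻¹)^T·M T ≤ Q`. [folklore] -/
theorem top_weight_le {M : ℕ → ℝ} {T : ℕ} {Q Lr : ℝ} (hL0 : 0 < Lr) (hMT : M T ≤ Q * Lr ^ T) : (Lr⁻¹) ^ T * M T ≤ Q := by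
  have h := mul_le_mul_of_nonneg_left hMT (pow_nonneg (inv_nonneg.mpr hL0.le) T)
  refine h.trans (le_of_eq ?_)
  rw [← mul_assoc, mul_comm ((Lr⁻¹) ^ T), mul_assoc, ← mul_pow, inv_mul_cancel₀ hL0.ne', one_pow, mul_one]

/-- **(T3) THE MULTIPLIER MASSES**: `0 ≤ M (s+1) ≤ Q·L^{s+1}` (`s < T`), `L ≥ 2` ⟹ `Σ_{s<T} (L⁻¹)^{3s}·M (s+1)² ≤ 2·Q²·L²` (row NE7b's weights `(L∕L⁴)^{j−i} = L^{−3(t−1)}` against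
squared masses growing like `L^{2t}`: room `L` per level). [folklore] -/
theorem sum_cube_weight_sq_le {M : ℕ → ℝ} {T : ℕ} {Q Lr : ℝ} (hL2 : 2 ≤ Lr) (hM0 : ∀ s < T, 0 ≤ M (s + 1))
    (hMt : ∀ s < T, M (s + 1) ≤ Q * Lr ^ (s + 1)) :
    ∑ s ∈ range T, (Lr⁻¹) ^ (3 * s) * M (s + 1) ^ 2 ≤ 2 * Q ^ 2 * Lr ^ 2 := by
  have hL0 : 0 < Lr := by linarith
  have hq0 : 0 ≤ Lr⁻¹ := by positivity
  have hq2 : Lr⁻¹ ≤ 1 / 2 := by rw [inv_eq_one_div]; exact one_div_le_one_div_of_le (by norm_num) hL2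
  have hterm : ∀ s ∈ range T, (Lr⁻¹) ^ (3 * s) * M (s + 1) ^ 2 ≤ Q ^ 2 * Lr ^ 2 * (Lr⁻¹) ^ s := by
    intro s hs
    have hsT := Finset.mem_range.mp hs
    have hsq : M (s + 1) ^ 2 ≤ (Q * Lr ^ (s + 1)) ^ 2 := pow_le_pow_left₀ (hM0 s hsT) (hMt s hsT) 2
    have h := mul_le_mul_of_nonneg_left hsq (pow_nonneg hq0 (3 * s))
    refine h.trans (le_of_eq ?_)
    have e : (Lr⁻¹) ^ (3 * s) * (Lr ^ (s + 1)) ^ 2 = Lr ^ 2 * (Lr⁻¹) ^ s := by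
      have e1 : (Lr ^ (s + 1)) ^ 2 = Lr ^ 2 * (Lr ^ s) ^ 2 := by ring
      have e2 : (Lr⁻¹) ^ (3 * s) = (Lr⁻¹) ^ s * ((Lr⁻¹) ^ s) ^ 2 := by ring
      rw [e1, e2]
      have e3 : ((Lr⁻¹) ^ s) ^ 2 * (Lr ^ s) ^ 2 = 1 := by
        rw [← mul_pow, ← mul_pow, inv_mul_cancel₀ hL0.ne', one_pow, one_pow]
      calc (Lr⁻¹) ^ s * ((Lr⁻¹) ^ s) ^ 2 * (Lr ^ 2 * (Lr ^ s) ^ 2) = Lr ^ 2 * (Lr⁻¹) ^ s * (((Lr⁻¹) ^ s) ^ 2 * (Lr ^ s) ^ 2) := by ring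
        _ = Lr ^ 2 * (Lr⁻¹) ^ s := by rw [e3, mul_one]
    calc (Lr⁻¹) ^ (3 * s) * (Q * Lr ^ (s + 1)) ^ 2 = Q ^ 2 * ((Lr⁻¹) ^ (3 * s) * (Lr ^ (s + 1)) ^ 2) := by ring
      _ = Q ^ 2 * Lr ^ 2 * (Lr⁻¹) ^ s := by rw [e]; ring
  calc ∑ s ∈ range T, (Lr⁻¹) ^ (3 * s) * M (s + 1) ^ 2 ≤ ∑ s ∈ range T, Q ^ 2 * Lr ^ 2 * (Lr⁻¹) ^ s := Finset.sum_le_sum hterm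
    _ = Q ^ 2 * Lr ^ 2 * ∑ s ∈ range T, (Lr⁻¹) ^ s := by rw [Finset.mul_sum]
    _ ≤ Q ^ 2 * Lr ^ 2 * 2 := mul_le_mul_of_nonneg_left (geom_sum_le_two hq0 hq2 T) (by positivity)
    _ = 2 * Q ^ 2 * Lr ^ 2 := by ring

/-! ## §6 Absorption of the energy feedback -/

/-- **ABSORPTION**: `S ≤ α + β·S`, `0 ≤ α`, `β ≤ 1∕2` ⟹ `S ≤ 2α` (closing `B̄ = A·(e_0 + c·S)` where `S` is the tower-remainder sum (T1)). [folklore] -/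
theorem le_two_mul_of_le_add_mul {S α β : ℝ} (hα : 0 ≤ α) (hβ : β ≤ 1 / 2) (h : S ≤ α + β * S) : S ≤ 2 * α := by
  by_cases hS : 0 ≤ S
  · nlinarith
  · linarith

/-! ## §7 From level indexing to depth indexing -/

/-- **RE-INDEXING**: level-indexed one-step letters `m i ≤ ρ′ i·m (i+1) + B′ i` for `i < T` (level `i = 0` finest, `T` the coarse datum) give, for the DEPTH sequence `M t := m (T − t)`,
the forward recursion `M (t+1) ≤ ρ′ (T−1−t)·M t + B′ (T−1−t)` for `t < T`. [folklore] -/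
theorem depth_recursion_of_level {m ρ' B' : ℕ → ℝ} {T : ℕ} (h : ∀ i < T, m i ≤ ρ' i * m (i + 1) + B' i) :
    ∀ t < T, m (T - (t + 1)) ≤ ρ' (T - 1 - t) * m (T - t) + B' (T - 1 - t) := by
  intro t ht
  have e1 : T - 1 - t = T - (t + 1) := by omega
  have e2 : T - t = T - (t + 1) + 1 := by omega
  rw [e1, e2]
  exact h _ (by omega)

end

end Summit.QuantumFields.BalabanUV.T4Continuum.NE7HierarchicalBookkeeping
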